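import Summits.Ventures.PackingBounds.Configurations.IcosahedronUnique
import Summits.Ventures.PackingBounds.Codes.Icosahedron

/-!
# The regular icosahedron is the unique optimal `12`-point code at angle `arccos(1/√5)` in `ℝ³`

Framing: lottery ticket; floor = certified bounds/negative ranges. Venture `PackingBounds` (cell
`pub-packcert`, seat `pub-packcert-energy`) — Cohn–Kumar Table 1, row `(3, 12)`, code form of the uniqueness.

`IcosahedronUnique.isometric_icosahedron` proves uniqueness of the `12`-point node-set configurations (inner products
in `{-1} ∪ {t² = 1/5}`). Complementary slackness for the tree's sharp Delsarte certificate of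
`A(3, arccos(1/√5)) ≤ 12` (`Codes.icosahedron_card_le_12`: `f = λ (t+1)(t+1/√5)²(t-1/√5)`, `λ = 75/8 - (15/8)√5 > 0`)
shows that every `12`-point code with pairwise inner products `≤ 1/√5` IS such a node-set configuration
(`inner_mem_of_card_eq_12`); hence **any `12` unit vectors of `ℝ³` with pairwise inner products `≤ 1/√5` form a
regular icosahedron** (`isometric_icosahedron_of_code`), and the one-statement form
`code_dim3_icosahedron_unique` (`IsGreatest … 12 ∧` any two optimal codes isometric).

## References
* H. Cohn, A. Kumar, J. Amer. Math. Soc. 20 (2007) 99–148, Table 1 and Appendix A. [`CohnKumar2006`]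
-/

noncomputable section

namespace Summit.Ventures.PackingBounds.Config.IcosahedronCodeUnique

open Finset Literature.Analysis.SpecialFunctions Literature.Geometry.DiscreteGeometry

/-- `(√5)² = 5` and an enclosure. -/
private theorem s5 : Real.sqrt 5 ^ 2 = 5 ∧ (2.2360679 : ℝ) < Real.sqrt 5 ∧ Real.sqrt 5 < 2.236068 :=
  ⟨Real.sq_sqrt (by norm_num), (Real.lt_sqrt (by norm_num)).mpr (by norm_num),
    (Real.sqrt_lt' (by norm_num)).mpr (by norm_num)⟩

/-- The certificate `f = Σ f_k P_k = λ (t+1)(t+1/√5)²(t-1/√5)` of `Codes.icosahedron_card_le_12`. -/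
private theorem hpoly (t : ℝ) : ∑ k ∈ range (4 + 1),
    (fun k => match k with
      | 0 => (1 : ℝ) | 1 => (3 : ℝ) | 2 => (((20 : ℝ) / 7) + ((3 : ℝ) / 7) * Real.sqrt 5) | 3 => (3 : ℝ)
      | 4 => (((15 : ℝ) / 7) + ((-3 : ℝ) / 7) * Real.sqrt 5) | _ => 0) k * gegenbauerSum (1 / 2 : ℝ) k t =
    (((75 : ℝ) / 8) + ((-15 : ℝ) / 8) * Real.sqrt 5) * ((t + 1) * ((t + Real.sqrt 5 / 5) ^ 2 *
      (t - Real.sqrt 5 / 5))) := by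
  have hX := s5.1
  simp [Finset.sum_range_succ, gegenbauerSum, gegenbauerCoeff, Finset.prod_range_succ, Nat.factorial]
  linear_combination (((-3 : ℝ) / 40) + ((3 : ℝ) / 40) * Real.sqrt 5 ^ 1 + ((-3 : ℝ) / 200) *
      Real.sqrt 5 ^ 2 + ((3 : ℝ) / 10) * t ^ 1 + ((-3 : ℝ) / 200) * t ^ 1 * Real.sqrt 5 ^ 2 +
      ((3 : ℝ) / 4) * t ^ 2 + ((-3 : ℝ) / 40) * t ^ 2 * Real.sqrt 5 ^ 1 + ((3 : ℝ) / 8) * t ^ 3) * hX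

/-- **Inner products of a `12`-point code at angle `arccos(1/√5)` in `ℝ³`** are `-1` or `±1/√5`
(complementary slackness). [cite: CohnKumar2006, Table 1] -/
theorem inner_mem_of_card_eq_12 {C : Finset (EuclideanSpace ℝ (Fin 3))} (h1 : ∀ x ∈ C, ‖x‖ = 1)
    (h2 : ∀ x ∈ C, ∀ y ∈ C, x ≠ y → inner ℝ x y ≤ Real.sqrt 5 / 5) (hN : C.card = 12)
    {x y : EuclideanSpace ℝ (Fin 3)} (hx : x ∈ C) (hy : y ∈ C) (hxy : x ≠ y) :
    inner ℝ x y = -1 ∨ inner ℝ x y ^ 2 = 1 / 5 := by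
  obtain ⟨hX, hlo, hhi⟩ := s5
  have h0 := DelsarteLP.sum_eq_zero_of_card_mul_eq (n := 3) (μ := 1 / 2) (by norm_num) (by norm_num) 4
    (fun k => match k with
      | 0 => (1 : ℝ) | 1 => (3 : ℝ) | 2 => (((20 : ℝ) / 7) + ((3 : ℝ) / 7) * Real.sqrt 5) | 3 => (3 : ℝ)
      | 4 => (((15 : ℝ) / 7) + ((-3 : ℝ) / 7) * Real.sqrt 5) | _ => 0)
    ?_ (Real.sqrt 5 / 5) ?_ C h1 h2 ?_ hx hy hxy
  · rw [hpoly] at h0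
    have hlam : (((75 : ℝ) / 8) + ((-15 : ℝ) / 8) * Real.sqrt 5) ≠ 0 := by nlinarith [hlo, hhi]
    rcases mul_eq_zero.mp h0 with h | h
    · exact absurd h hlam
    rcases mul_eq_zero.mp h with h | h
    · left; linarith
    rcases mul_eq_zero.mp h with h | h
    · right
      have h' := pow_eq_zero_iff two_ne_zero |>.mp h
      have : inner ℝ x y = -(Real.sqrt 5 / 5) := by linarith
      rw [this]; nlinarith [hX]
    · right
      have : inner ℝ x y = Real.sqrt 5 / 5 := by linarith
      rw [this]; nlinarith [hX]
  · intro k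
    split <;> linarith [hlo, hhi]
  · intro t ht1 ht2
    rw [hpoly]
    have hlam : 0 ≤ (((75 : ℝ) / 8) + ((-15 : ℝ) / 8) * Real.sqrt 5) := by linarith [hlo, hhi]
    exact mul_nonpos_of_nonneg_of_nonpos hlam (mul_nonpos_of_nonneg_of_nonpos (by linarith)
      (mul_nonpos_of_nonneg_of_nonpos (sq_nonneg _) (by linarith)))
  · rw [hN]
    have hv : ∑ k ∈ range (4 + 1),
      (fun k => match k with
        | 0 => (1 : ℝ) | 1 => (3 : ℝ) | 2 => (((20 : ℝ) / 7) + ((3 : ℝ) / 7) * Real.sqrt 5) | 3 => (3 : ℝ)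
        | 4 => (((15 : ℝ) / 7) + ((-3 : ℝ) / 7) * Real.sqrt 5) | _ => 0) k * gegenbauerSum (1 / 2 : ℝ) k 1 = 12 := by
      simp [Finset.sum_range_succ, gegenbauerSum, gegenbauerCoeff, Finset.prod_range_succ, Nat.factorial]
      ring
    rw [hv]
    norm_num

/-- **The regular icosahedron is the unique optimal `12`-point code at angle `arccos(1/√5)`**: every set of `12` unit
vectors of `ℝ³` with pairwise inner products `≤ 1/√5` is an isometric image of `Config.Icosahedron.pts`.
[cite: CohnKumar2006, Appendix A] -/
theorem isometric_icosahedron_of_code {C : Finset (EuclideanSpace ℝ (Fin 3))} (h1 : ∀ x ∈ C, ‖x‖ = 1)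
    (h2 : ∀ x ∈ C, ∀ y ∈ C, x ≠ y → inner ℝ x y ≤ Real.sqrt 5 / 5) (hN : C.card = 12) :
    ∃ Ψ : EuclideanSpace ℝ (Fin 3) ≃ₗᵢ[ℝ] EuclideanSpace ℝ (Fin 3), C = Icosahedron.pts.image Ψ :=
  IcosahedronUnique.isometric_icosahedron h1 hN fun _ hx _ hy hxy => inner_mem_of_card_eq_12 h1 h2 hN hx hy hxy

/-- Any two optimal `12`-point codes at angle `arccos(1/√5)` in `ℝ³` are isometric. -/
theorem isometric {C C' : Finset (EuclideanSpace ℝ (Fin 3))} (h1 : ∀ x ∈ C, ‖x‖ = 1)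
    (h2 : ∀ x ∈ C, ∀ y ∈ C, x ≠ y → inner ℝ x y ≤ Real.sqrt 5 / 5) (hN : C.card = 12)
    (h1' : ∀ x ∈ C', ‖x‖ = 1) (h2' : ∀ x ∈ C', ∀ y ∈ C', x ≠ y → inner ℝ x y ≤ Real.sqrt 5 / 5)
    (hN' : C'.card = 12) :
    ∃ Ψ : EuclideanSpace ℝ (Fin 3) ≃ₗᵢ[ℝ] EuclideanSpace ℝ (Fin 3), C' = C.image Ψ :=
  IcosahedronUnique.isometric h1 hN (fun _ hx _ hy hxy => inner_mem_of_card_eq_12 h1 h2 hN hx hy hxy) h1' hN'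
    fun _ hx _ hy hxy => inner_mem_of_card_eq_12 h1' h2' hN' hx hy hxy

/-- **`A(3, arccos(1/√5)) = 12` with uniqueness** (one-statement form). [cite: CohnKumar2006, Appendix A] -/
theorem code_dim3_icosahedron_unique :
    IsGreatest {N : ℕ | ∃ C : Finset (EuclideanSpace ℝ (Fin 3)),
      C.card = N ∧ (∀ x ∈ C, ‖x‖ = 1) ∧ (∀ x ∈ C, ∀ y ∈ C, x ≠ y → inner ℝ x y ≤ Real.sqrt 5 / 5)} 12 ∧
    ∀ C C' : Finset (EuclideanSpace ℝ (Fin 3)),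
      (∀ x ∈ C, ‖x‖ = 1) → (∀ x ∈ C, ∀ y ∈ C, x ≠ y → inner ℝ x y ≤ Real.sqrt 5 / 5) → C.card = 12 →
      (∀ x ∈ C', ‖x‖ = 1) → (∀ x ∈ C', ∀ y ∈ C', x ≠ y → inner ℝ x y ≤ Real.sqrt 5 / 5) → C'.card = 12 →
      ∃ Ψ : EuclideanSpace ℝ (Fin 3) ≃ₗᵢ[ℝ] EuclideanSpace ℝ (Fin 3), C' = C.image Ψ := by
  classical
  obtain ⟨hX, hlo, hhi⟩ := s5
  refine ⟨⟨?_, ?_⟩, fun C C' h1 h2 hN h1' h2' hN' => isometric h1 h2 hN h1' h2' hN'⟩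
  · -- attained by the icosahedron: read the code property off its energy identity with an indicator potential
    have hq : 0 < (Zsqrtd.toReal Icosahedron.h5) (⟨10, 2⟩ : Zsqrtd 5) := by
      rw [Zsqrtd.toReal_apply]; push_cast; nlinarith
    have hsh : shapeOK Icosahedron.vecs 3 (⟨10, 2⟩ : Zsqrtd 5) = true := by decide +kernel
    have hn1 : ∀ x ∈ Icosahedron.pts, ‖x‖ = 1 := norm_eq_one hq hsh
    refine ⟨Icosahedron.pts, Icosahedron.card_pts, hn1, ?_⟩
    set ind : ℝ → ℝ := fun t => if t ≤ Real.sqrt 5 / 5 then 0 else 1 with hind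
    have hE := Icosahedron.energy_pts ind
    have hval : ind (-1) = 0 ∧ ind (-(Real.sqrt 5 / 5)) = 0 ∧ ind (Real.sqrt 5 / 5) = 0 := by
      refine ⟨?_, ?_, ?_⟩ <;> (simp only [hind]; rw [if_pos]; nlinarith [hlo])
    rw [hval.1, hval.2.1, hval.2.2] at hE
    norm_num at hE
    have hnn : ∀ x ∈ Icosahedron.pts, ∀ y ∈ Icosahedron.pts.erase x, 0 ≤ ind (inner ℝ x y) := by
      intro x _ y _; simp only [hind]; split_ifs <;> norm_num
    intro x hx y hy hxy
    have hx0 := (Finset.sum_eq_zero_iff_of_nonneg fun x hx => Finset.sum_nonneg fun y hy => hnn x hx y hy).mp hE x hx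
    have h0 := (Finset.sum_eq_zero_iff_of_nonneg fun y hy => hnn x hx y hy).mp hx0 y
      (Finset.mem_erase.mpr ⟨hxy.symm, hy⟩)
    simp only [hind] at h0
    by_contra hc
    rw [if_neg hc] at h0
    exact one_ne_zero h0
  · rintro N ⟨C, rfl, h1, h2⟩
    exact Codes.icosahedron_card_le_12 C h1 h2

end Summit.Ventures.PackingBounds.Config.IcosahedronCodeUnique

end
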